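import Summits.CriticalPhenomena.PercolationContinuityZ3.Theorems.PercNearOneGluingNoHeavyLowerTailSahiCombSigmaStratumFpGq
import Summits.CriticalPhenomena.PercolationContinuityZ3.Theorems.PercNearOneGluingNoHeavyLowerTailSahiCombTriWCompression

/-!
# `TRI_W(2) ≥ 0` on the stratum `F_∅ = F_p`, `G_∅ = G_q` — the counting bridge from the Σ-kernel theorem

Support file of the one-cut programme (crux `NoHeavyLowerTail`, stmt-CriticalPhenomena-4575; TRI lane of cell `prim-masterthm`; seat prim-lf-1 gen 26,
memo `FROM-prim-lf-1-gen26-PRINCIPAL-AND-NOGO.md` §5a).  Companion of `…SahiCombSigmaStratumFpGq` (`sigma_kernel_eq_zero_stratum_FpGq`).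

* `FiveUpSet.sigma_kernel_eq_zero_stratum_FpGq_of_upperSet` — the kernel theorem inside an arbitrary up-set `P` (free restriction: a token `d ∈ P`
  only sees supplies `t ⊇ d`, which lie in `P`);
* `FiveUpSet.sigma_count_stratum_FpGq` — the COUNTING consequence: with `A ⊆ B ⊆ C`, `D ⊆ E ⊆ H` up-sets and `P` an up-set, the twelve token
  counts (classes `L_x, R_x, K_x` inside `P`) are at most the twelve supply counts (two copies of the four fibres `P ∩ U_y` plus the four tag
  classes) — the rows of the Σ matrix (12 row blocks × 12 column blocks, entries `κ·[d ⊆ t] + τ·[d = t]`) are linearly independent;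
* **`FiveUpSet.triW_nonneg_of_stratum_FpGq`** — for an index cube with two atoms `a ≠ b`, an up-set `P` and monotone families of up-sets
  `F, G` with `F ∅ = F {a}` and `G ∅ = G {b}`: `0 ≤ triW P F G` (via `LatticeFiveUpSet.triW_nonneg_of_pair_nonneg`).
WHY IT MATTERS: P5 gen 15 showed this stratum has NO pointwise / type-LP certificate (LP value −1/16); this is the first stratum of `TriWIneq`
at `a = 2` in the tree that lies beyond that wall (proved by the rank method).
HONEST LABEL: one unconditional stratum theorem; `TriWIneq` / `CertSigmaKernelZero` remain OPEN. [this work]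
-/

namespace Summit.CriticalPhenomena.PercolationContinuityZ3.Theorems

namespace FiveUpSet

open Finset

variable {α : Type} [DecidableEq α] [Fintype α]

/-! ### The kernel theorem inside an up-set `P` -/

/-- `sigma_kernel_eq_zero_stratum_FpGq` inside an arbitrary up-set `P`: supports inside `P`, equations only on `P`. [this work] -/
theorem sigma_kernel_eq_zero_stratum_FpGq_of_upperSet (P A B C D E H : Finset (Finset α))
    (hP : IsUpperSet (P : Set (Finset α)))
    (hA : IsUpperSet (A : Set (Finset α))) (hB : IsUpperSet (B : Set (Finset α))) (hC : IsUpperSet (C : Set (Finset α)))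
    (hD : IsUpperSet (D : Set (Finset α))) (hE : IsUpperSet (E : Set (Finset α))) (hH : IsUpperSet (H : Set (Finset α)))
    (hAB : A ⊆ B) (hBC : B ⊆ C) (hDE : D ⊆ E) (hEH : E ⊆ H)
    (l0 lp lq l1 r0 rp rq r1 k0 kp kq k1 : Finset α → ℚ)
    (sl0 : ∀ d, l0 d ≠ 0 → d ∈ P ∧ d ∈ A ∧ dᶜ ∈ H) (slp : ∀ d, lp d ≠ 0 → d ∈ P ∧ d ∈ A ∧ dᶜ ∈ D)
    (slq : ∀ d, lq d ≠ 0 → d ∈ P ∧ d ∈ B ∧ dᶜ ∈ E) (sl1 : ∀ d, l1 d ≠ 0 → d ∈ P ∧ d ∈ C ∧ dᶜ ∈ D)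
    (sr0 : ∀ d, r0 d ≠ 0 → d ∈ P ∧ dᶜ ∈ A ∧ d ∈ H) (srp : ∀ d, rp d ≠ 0 → d ∈ P ∧ dᶜ ∈ A ∧ d ∈ D)
    (srq : ∀ d, rq d ≠ 0 → d ∈ P ∧ dᶜ ∈ B ∧ d ∈ E) (sr1 : ∀ d, r1 d ≠ 0 → d ∈ P ∧ dᶜ ∈ C ∧ d ∈ D)
    (sk0 : ∀ d, k0 d ≠ 0 → d ∈ P ∧ dᶜ ∈ A ∧ dᶜ ∈ D) (skp : ∀ d, kp d ≠ 0 → d ∈ P ∧ dᶜ ∈ A ∧ dᶜ ∈ E)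
    (skq : ∀ d, kq d ≠ 0 → d ∈ P ∧ dᶜ ∈ B ∧ dᶜ ∈ D) (sk1 : ∀ d, k1 d ≠ 0 → d ∈ P ∧ dᶜ ∈ C ∧ dᶜ ∈ H)
    (e10 : ∀ t, t ∈ P → t ∈ A → t ∈ D → zsum l0 t + zsum r0 t + zsum k0 t = 0)
    (e1p : ∀ t, t ∈ P → t ∈ A → t ∈ E → zsum l0 t + zsum r0 t + zsum rp t + zsum k0 t = 0)
    (e1q : ∀ t, t ∈ P → t ∈ B → t ∈ D → zsum l0 t + zsum r0 t + zsum rq t + zsum k0 t = 0)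
    (e11 : ∀ t, t ∈ P → t ∈ C → t ∈ H → zsum l0 t + zsum l1 t + zsum r0 t + zsum rp t + zsum rq t + zsum k0 t + zsum k1 t = 0)
    (e20 : ∀ t, t ∈ P → t ∈ A → t ∈ D → zsum l0 t = 0)
    (e2p : ∀ t, t ∈ P → t ∈ A → t ∈ E → zsum l0 t + zsum lp t + zsum rp t + zsum kp t = 0)
    (e2q : ∀ t, t ∈ P → t ∈ B → t ∈ D → zsum l0 t + zsum lq t + zsum rq t + zsum kq t = 0)
    (e21 : ∀ t, t ∈ P → t ∈ C → t ∈ H →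
      zsum l0 t + zsum lp t + zsum lq t + zsum rp t + zsum rq t + zsum r1 t + zsum kp t + zsum kq t = 0)
    (tg0 : ∀ e, e ∈ P → eᶜ ∈ A → eᶜ ∈ H → k0 e + kp e + kq e + k1 e = 0)
    (tgp : ∀ e, e ∈ P → eᶜ ∈ A → eᶜ ∈ D → kp e + k1 e = 0)
    (tgq : ∀ e, e ∈ P → eᶜ ∈ B → eᶜ ∈ E → kq e + k1 e = 0)
    (tg1 : ∀ e, e ∈ P → eᶜ ∈ C → eᶜ ∈ D → k1 e = 0) :
    (∀ d, l0 d = 0) ∧ (∀ d, lp d = 0) ∧ (∀ d, lq d = 0) ∧ (∀ d, l1 d = 0) ∧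
    (∀ d, r0 d = 0) ∧ (∀ d, rp d = 0) ∧ (∀ d, rq d = 0) ∧ (∀ d, r1 d = 0) ∧
    (∀ d, k0 d = 0) ∧ (∀ d, kp d = 0) ∧ (∀ d, kq d = 0) ∧ (∀ d, k1 d = 0) := by
  -- every zeta sum vanishes off `P`
  have nz : ∀ (f : Finset α → ℚ), (∀ d, f d ≠ 0 → d ∈ P) → ∀ t, t ∉ P → zsum f t = 0 :=
    fun f hf t ht => zsum_eq_zero_of_not_mem hP f hf ht
  have pl0 := nz l0 (fun d hd => (sl0 d hd).1); have plp := nz lp (fun d hd => (slp d hd).1)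
  have plq := nz lq (fun d hd => (slq d hd).1); have pl1 := nz l1 (fun d hd => (sl1 d hd).1)
  have pr0 := nz r0 (fun d hd => (sr0 d hd).1); have prp := nz rp (fun d hd => (srp d hd).1)
  have prq := nz rq (fun d hd => (srq d hd).1); have pr1 := nz r1 (fun d hd => (sr1 d hd).1)
  have pk0 := nz k0 (fun d hd => (sk0 d hd).1); have pkp := nz kp (fun d hd => (skp d hd).1)
  have pkq := nz kq (fun d hd => (skq d hd).1); have pk1 := nz k1 (fun d hd => (sk1 d hd).1)
  have vz : ∀ (f : Finset α → ℚ), (∀ d, f d ≠ 0 → d ∈ P) → ∀ e, e ∉ P → f e = 0 := by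
    intro f hf e he; by_contra hne; exact he (hf e hne)
  refine sigma_kernel_eq_zero_stratum_FpGq A B C D E H hA hB hC hD hE hH hAB hBC hDE hEH
    l0 lp lq l1 r0 rp rq r1 k0 kp kq k1
    (fun d hd => (sl0 d hd).2) (fun d hd => (slp d hd).2) (fun d hd => (slq d hd).2) (fun d hd => (sl1 d hd).2)
    (fun d hd => (sr0 d hd).2) (fun d hd => (srp d hd).2) (fun d hd => (srq d hd).2) (fun d hd => (sr1 d hd).2)
    (fun d hd => (sk0 d hd).2) (fun d hd => (skp d hd).2) (fun d hd => (skq d hd).2) (fun d hd => (sk1 d hd).2)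
    ?_ ?_ ?_ ?_ ?_ ?_ ?_ ?_ ?_ ?_ ?_ ?_
  · intro t h1 h2; by_cases ht : t ∈ P
    · exact e10 t ht h1 h2
    · rw [pl0 t ht, pr0 t ht, pk0 t ht]; ring
  · intro t h1 h2; by_cases ht : t ∈ P
    · exact e1p t ht h1 h2
    · rw [pl0 t ht, pr0 t ht, prp t ht, pk0 t ht]; ring
  · intro t h1 h2; by_cases ht : t ∈ P
    · exact e1q t ht h1 h2
    · rw [pl0 t ht, pr0 t ht, prq t ht, pk0 t ht]; ring
  · intro t h1 h2; by_cases ht : t ∈ P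
    · exact e11 t ht h1 h2
    · rw [pl0 t ht, pl1 t ht, pr0 t ht, prp t ht, prq t ht, pk0 t ht, pk1 t ht]; ring
  · intro t h1 h2; by_cases ht : t ∈ P
    · exact e20 t ht h1 h2
    · exact pl0 t ht
  · intro t h1 h2; by_cases ht : t ∈ P
    · exact e2p t ht h1 h2
    · rw [pl0 t ht, plp t ht, prp t ht, pkp t ht]; ring
  · intro t h1 h2; by_cases ht : t ∈ P
    · exact e2q t ht h1 h2
    · rw [pl0 t ht, plq t ht, prq t ht, pkq t ht]; ring
  · intro t h1 h2; by_cases ht : t ∈ P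
    · exact e21 t ht h1 h2
    · rw [pl0 t ht, plp t ht, plq t ht, prp t ht, prq t ht, pr1 t ht, pkp t ht, pkq t ht]; ring
  · intro e h1 h2; by_cases he : e ∈ P
    · exact tg0 e he h1 h2
    · rw [vz k0 (fun d hd => (sk0 d hd).1) e he, vz kp (fun d hd => (skp d hd).1) e he,
        vz kq (fun d hd => (skq d hd).1) e he, vz k1 (fun d hd => (sk1 d hd).1) e he]; ring
  · intro e h1 h2; by_cases he : e ∈ P
    · exact tgp e he h1 h2
    · rw [vz kp (fun d hd => (skp d hd).1) e he, vz k1 (fun d hd => (sk1 d hd).1) e he]; ring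
  · intro e h1 h2; by_cases he : e ∈ P
    · exact tgq e he h1 h2
    · rw [vz kq (fun d hd => (skq d hd).1) e he, vz k1 (fun d hd => (sk1 d hd).1) e he]; ring
  · intro e h1 h2; by_cases he : e ∈ P
    · exact tg1 e he h1 h2
    · exact vz k1 (fun d hd => (sk1 d hd).1) e he

/-! ### A bookkeeping lemma: sums over a token subtype are zeta sums of the extended coefficient vector -/

omit [Fintype α] in
/-- For a finset `S` of points and `g : ↥S → ℚ`, with the extension `a d = g ⟨d,·⟩` on `S` and `0` off `S`:
`Σ_{d : S} g d · φ d = Σ_{d ∈ S} a d · φ d`. [this work] -/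
theorem sum_subtype_ext [Fintype α] (S : Finset (Finset α)) (g : ↥S → ℚ) (a : Finset α → ℚ)
    (ha : ∀ d, a d = if h : d ∈ S then g ⟨d, h⟩ else 0) (φ : Finset α → ℚ) :
    ∑ d : ↥S, g d * φ d = ∑ d, a d * φ d := by
  have h1 : ∑ d, a d * φ d = ∑ d ∈ S, a d * φ d := by
    refine (Finset.sum_subset (subset_univ _) ?_).symm
    intro d _ hd
    rw [ha d, dif_neg hd, zero_mul]
  rw [h1]
  conv_rhs => rw [← Finset.sum_coe_sort]
  refine Finset.sum_congr rfl fun d _ => ?_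
  rw [ha d, dif_pos d.2]

/-! ### The counting theorem -/

/-- **Counting on the stratum.**  `P` an up-set, `A ⊆ B ⊆ C`, `D ⊆ E ⊆ H` up-sets: the twelve token counts (inside `P`) of the Σ certificate are at
most the twelve supply counts: `Σ_x (#L_x + #R_x + #K_x) ≤ 2·Σ_y #U_y + Σ_x #T4_x` in the six-up-set presentation. [this work] -/
theorem sigma_count_stratum_FpGq (P A B C D E H : Finset (Finset α)) (hP : IsUpperSet (P : Set (Finset α)))
    (hA : IsUpperSet (A : Set (Finset α))) (hB : IsUpperSet (B : Set (Finset α))) (hC : IsUpperSet (C : Set (Finset α)))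
    (hD : IsUpperSet (D : Set (Finset α))) (hE : IsUpperSet (E : Set (Finset α))) (hH : IsUpperSet (H : Set (Finset α)))
    (hAB : A ⊆ B) (hBC : B ⊆ C) (hDE : D ⊆ E) (hEH : E ⊆ H) :
    ((P ∩ A ∩ refl H).card + (P ∩ A ∩ refl D).card + (P ∩ B ∩ refl E).card + (P ∩ C ∩ refl D).card)
      + ((P ∩ refl A ∩ H).card + (P ∩ refl A ∩ D).card + (P ∩ refl B ∩ E).card + (P ∩ refl C ∩ D).card)
      + ((P ∩ refl A ∩ refl D).card + (P ∩ refl A ∩ refl E).card + (P ∩ refl B ∩ refl D).card + (P ∩ refl C ∩ refl H).card)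
    ≤ 2 * ((P ∩ A ∩ D).card + (P ∩ A ∩ E).card + (P ∩ B ∩ D).card + (P ∩ C ∩ H).card)
      + ((P ∩ refl A ∩ refl H).card + (P ∩ refl A ∩ refl D).card + (P ∩ refl B ∩ refl E).card + (P ∩ refl C ∩ refl D).card) := by
  -- token sets (rows) and supply/tag sets (columns), indexed by `Fin 12`
  set S : Fin 12 → Finset (Finset α) := fun i =>
    match i with
    | 0 => P ∩ A ∩ refl H | 1 => P ∩ A ∩ refl D | 2 => P ∩ B ∩ refl E | 3 => P ∩ C ∩ refl D
    | 4 => P ∩ refl A ∩ H | 5 => P ∩ refl A ∩ D | 6 => P ∩ refl B ∩ E | 7 => P ∩ refl C ∩ D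
    | 8 => P ∩ refl A ∩ refl D | 9 => P ∩ refl A ∩ refl E | 10 => P ∩ refl B ∩ refl D | 11 => P ∩ refl C ∩ refl H
    with hSdef
  set T : Fin 12 → Finset (Finset α) := fun j =>
    match j with
    | 0 => P ∩ A ∩ D | 1 => P ∩ A ∩ E | 2 => P ∩ B ∩ D | 3 => P ∩ C ∩ H
    | 4 => P ∩ A ∩ D | 5 => P ∩ A ∩ E | 6 => P ∩ B ∩ D | 7 => P ∩ C ∩ H
    | 8 => P ∩ refl A ∩ refl H | 9 => P ∩ refl A ∩ refl D | 10 => P ∩ refl B ∩ refl E | 11 => P ∩ refl C ∩ refl D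
    with hTdef
  -- the Σ table: class code `c = i / 4` (0 = L, 1 = R, 2 = K), index code `x = i % 4` (0=∅,1=p,2=q,3=⊤); column `j < 8`: fibre `j % 4`, copy `j / 4`
  set κ : Fin 12 → Fin 12 → ℚ := fun i j =>
    if j.val < 8 ∧ (i.val % 4 = 0 ∨ i.val % 4 = j.val % 4 ∨ j.val % 4 = 3) ∧
      ((i.val / 4 = 0 ∧ (i.val % 4 = 0 ∨ ((i.val % 4 = 1 ∨ i.val % 4 = 2) ∧ j.val / 4 = 1) ∨ (i.val % 4 = 3 ∧ j.val / 4 = 0))) ∨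
       (i.val / 4 = 1 ∧ ((i.val % 4 = 0 ∧ j.val / 4 = 0) ∨ (i.val % 4 = 1 ∨ i.val % 4 = 2) ∨ (i.val % 4 = 3 ∧ j.val / 4 = 1))) ∨
       (i.val / 4 = 2 ∧ ((i.val % 4 = 0 ∧ j.val / 4 = 0) ∨ ((i.val % 4 = 1 ∨ i.val % 4 = 2) ∧ j.val / 4 = 1) ∨ (i.val % 4 = 3 ∧ j.val / 4 = 0))))
    then (1 : ℚ) else 0 with hκdef
  set τ : Fin 12 → Fin 12 → ℚ := fun i j =>
    if 8 ≤ j.val ∧ i.val / 4 = 2 ∧ (j.val - 8 = 0 ∨ j.val - 8 = i.val % 4 ∨ i.val % 4 = 3) then (1 : ℚ) else 0 with hτdef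
  let v : (Σ i : Fin 12, ↥(S i)) → (Σ j : Fin 12, ↥(T j)) → ℚ := fun r c =>
    κ r.1 c.1 * (if (r.2 : Finset α) ⊆ (c.2 : Finset α) then (1 : ℚ) else 0)
      + τ r.1 c.1 * (if (r.2 : Finset α) = (c.2 : Finset α) then (1 : ℚ) else 0)
  have hli : LinearIndependent ℚ v := by
    rw [Fintype.linearIndependent_iff]
    intro g hg
    -- extended coefficient vectors
    have hext : ∀ i : Fin 12, ∃ a : Finset α → ℚ, ∀ d, a d = if h : d ∈ S i then g ⟨i, ⟨d, h⟩⟩ else 0 :=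
      fun i => ⟨_, fun _ => rfl⟩
    choose a ha using hext
    have hsupp : ∀ i d, a i d ≠ 0 → d ∈ S i := by
      intro i d hd; by_contra h; rw [ha i d, dif_neg h] at hd; exact hd rfl
    -- the column equations
    have hcol : ∀ (j : Fin 12) (t : Finset α), t ∈ T j →
        ∑ i : Fin 12, (κ i j * zsum (a i) t + τ i j * a i t) = 0 := by
      intro j t ht
      have h := congrFun hg ⟨j, ⟨t, ht⟩⟩
      rw [Finset.sum_apply, Fintype.sum_sigma] at h
      simp only [Pi.smul_apply, smul_eq_mul, Pi.zero_apply] at h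
      rw [← h]
      refine sum_congr rfl fun i _ => ?_
      have e1 : ∑ d : ↥(S i), g ⟨i, d⟩ * v ⟨i, d⟩ ⟨j, ⟨t, ht⟩⟩
          = ∑ d : ↥(S i), g ⟨i, d⟩
              * (κ i j * (if (d : Finset α) ⊆ t then (1 : ℚ) else 0) + τ i j * (if (d : Finset α) = t then (1 : ℚ) else 0)) := rfl
      have e3 := sum_subtype_ext (S i) (fun d' => g ⟨i, d'⟩) (a i) (ha i)
        (fun e => κ i j * (if e ⊆ t then (1 : ℚ) else 0) + τ i j * (if e = t then (1 : ℚ) else 0))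
      rw [e1, e3]
      unfold zsum
      have e2 : ∑ d, a i d * (if d = t then (1 : ℚ) else 0) = a i t := by
        rw [Finset.sum_eq_single t]
        · simp
        · intro d _ hdt; rw [if_neg hdt, mul_zero]
        · intro h; exact absurd (mem_univ t) h
      rw [← e2, mul_sum, mul_sum, ← sum_add_distrib]
      refine sum_congr rfl fun d _ => ?_
      ring
    -- read off the eight fibre equations and four tag equations
    have e10 : ∀ t, t ∈ P → t ∈ A → t ∈ D → zsum (a 0) t + zsum (a 4) t + zsum (a 8) t = 0 := by
      intro t h1 h2 h3
      have h := hcol 0 t (mem_inter.2 ⟨mem_inter.2 ⟨h1, h2⟩, h3⟩)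
      simp [Fin.sum_univ_succ, hκdef, hτdef] at h
      linarith
    have e1p : ∀ t, t ∈ P → t ∈ A → t ∈ E → zsum (a 0) t + zsum (a 4) t + zsum (a 5) t + zsum (a 8) t = 0 := by
      intro t h1 h2 h3
      have h := hcol 1 t (mem_inter.2 ⟨mem_inter.2 ⟨h1, h2⟩, h3⟩)
      simp [Fin.sum_univ_succ, hκdef, hτdef] at h
      linarith
    have e1q : ∀ t, t ∈ P → t ∈ B → t ∈ D → zsum (a 0) t + zsum (a 4) t + zsum (a 6) t + zsum (a 8) t = 0 := by
      intro t h1 h2 h3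
      have h := hcol 2 t (mem_inter.2 ⟨mem_inter.2 ⟨h1, h2⟩, h3⟩)
      simp [Fin.sum_univ_succ, hκdef, hτdef] at h
      linarith
    have e11 : ∀ t, t ∈ P → t ∈ C → t ∈ H → zsum (a 0) t + zsum (a 3) t + zsum (a 4) t + zsum (a 5) t + zsum (a 6) t
        + zsum (a 8) t + zsum (a 11) t = 0 := by
      intro t h1 h2 h3
      have h := hcol 3 t (mem_inter.2 ⟨mem_inter.2 ⟨h1, h2⟩, h3⟩)
      simp [Fin.sum_univ_succ, hκdef, hτdef] at h
      linarith
    have e20 : ∀ t, t ∈ P → t ∈ A → t ∈ D → zsum (a 0) t = 0 := by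
      intro t h1 h2 h3
      have h := hcol 4 t (mem_inter.2 ⟨mem_inter.2 ⟨h1, h2⟩, h3⟩)
      simp [Fin.sum_univ_succ, hκdef, hτdef] at h
      linarith
    have e2p : ∀ t, t ∈ P → t ∈ A → t ∈ E → zsum (a 0) t + zsum (a 1) t + zsum (a 5) t + zsum (a 9) t = 0 := by
      intro t h1 h2 h3
      have h := hcol 5 t (mem_inter.2 ⟨mem_inter.2 ⟨h1, h2⟩, h3⟩)
      simp [Fin.sum_univ_succ, hκdef, hτdef] at h
      linarith
    have e2q : ∀ t, t ∈ P → t ∈ B → t ∈ D → zsum (a 0) t + zsum (a 2) t + zsum (a 6) t + zsum (a 10) t = 0 := by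
      intro t h1 h2 h3
      have h := hcol 6 t (mem_inter.2 ⟨mem_inter.2 ⟨h1, h2⟩, h3⟩)
      simp [Fin.sum_univ_succ, hκdef, hτdef] at h
      linarith
    have e21 : ∀ t, t ∈ P → t ∈ C → t ∈ H → zsum (a 0) t + zsum (a 1) t + zsum (a 2) t + zsum (a 5) t + zsum (a 6) t
        + zsum (a 7) t + zsum (a 9) t + zsum (a 10) t = 0 := by
      intro t h1 h2 h3
      have h := hcol 7 t (mem_inter.2 ⟨mem_inter.2 ⟨h1, h2⟩, h3⟩)
      simp [Fin.sum_univ_succ, hκdef, hτdef] at h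
      linarith
    have tg0 : ∀ e, e ∈ P → eᶜ ∈ A → eᶜ ∈ H → a 8 e + a 9 e + a 10 e + a 11 e = 0 := by
      intro e h1 h2 h3
      have h := hcol 8 e (mem_inter.2 ⟨mem_inter.2 ⟨h1, mem_refl.2 h2⟩, mem_refl.2 h3⟩)
      simp [Fin.sum_univ_succ, hκdef, hτdef] at h
      linarith
    have tgp : ∀ e, e ∈ P → eᶜ ∈ A → eᶜ ∈ D → a 9 e + a 11 e = 0 := by
      intro e h1 h2 h3
      have h := hcol 9 e (mem_inter.2 ⟨mem_inter.2 ⟨h1, mem_refl.2 h2⟩, mem_refl.2 h3⟩)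
      simp [Fin.sum_univ_succ, hκdef, hτdef] at h
      linarith
    have tgq : ∀ e, e ∈ P → eᶜ ∈ B → eᶜ ∈ E → a 10 e + a 11 e = 0 := by
      intro e h1 h2 h3
      have h := hcol 10 e (mem_inter.2 ⟨mem_inter.2 ⟨h1, mem_refl.2 h2⟩, mem_refl.2 h3⟩)
      simp [Fin.sum_univ_succ, hκdef, hτdef] at h
      linarith
    have tg1 : ∀ e, e ∈ P → eᶜ ∈ C → eᶜ ∈ D → a 11 e = 0 := by
      intro e h1 h2 h3
      have h := hcol 11 e (mem_inter.2 ⟨mem_inter.2 ⟨h1, mem_refl.2 h2⟩, mem_refl.2 h3⟩)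
      simp [Fin.sum_univ_succ, hκdef, hτdef] at h
      linarith
    -- supports
    have m3 : ∀ {X Y : Finset (Finset α)} {d : Finset α}, d ∈ P ∩ X ∩ Y → d ∈ P ∧ d ∈ X ∧ d ∈ Y := by
      intro X Y d h
      exact ⟨(mem_inter.1 (mem_inter.1 h).1).1, (mem_inter.1 (mem_inter.1 h).1).2, (mem_inter.1 h).2⟩
    have K := sigma_kernel_eq_zero_stratum_FpGq_of_upperSet P A B C D E H hP hA hB hC hD hE hH hAB hBC hDE hEH
      (a 0) (a 1) (a 2) (a 3) (a 4) (a 5) (a 6) (a 7) (a 8) (a 9) (a 10) (a 11)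
      (fun d hd => by obtain ⟨h1, h2, h3⟩ := m3 (hsupp 0 d hd); exact ⟨h1, h2, mem_refl.1 h3⟩)
      (fun d hd => by obtain ⟨h1, h2, h3⟩ := m3 (hsupp 1 d hd); exact ⟨h1, h2, mem_refl.1 h3⟩)
      (fun d hd => by obtain ⟨h1, h2, h3⟩ := m3 (hsupp 2 d hd); exact ⟨h1, h2, mem_refl.1 h3⟩)
      (fun d hd => by obtain ⟨h1, h2, h3⟩ := m3 (hsupp 3 d hd); exact ⟨h1, h2, mem_refl.1 h3⟩)
      (fun d hd => by obtain ⟨h1, h2, h3⟩ := m3 (hsupp 4 d hd); exact ⟨h1, mem_refl.1 h2, h3⟩)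
      (fun d hd => by obtain ⟨h1, h2, h3⟩ := m3 (hsupp 5 d hd); exact ⟨h1, mem_refl.1 h2, h3⟩)
      (fun d hd => by obtain ⟨h1, h2, h3⟩ := m3 (hsupp 6 d hd); exact ⟨h1, mem_refl.1 h2, h3⟩)
      (fun d hd => by obtain ⟨h1, h2, h3⟩ := m3 (hsupp 7 d hd); exact ⟨h1, mem_refl.1 h2, h3⟩)
      (fun d hd => by obtain ⟨h1, h2, h3⟩ := m3 (hsupp 8 d hd); exact ⟨h1, mem_refl.1 h2, mem_refl.1 h3⟩)
      (fun d hd => by obtain ⟨h1, h2, h3⟩ := m3 (hsupp 9 d hd); exact ⟨h1, mem_refl.1 h2, mem_refl.1 h3⟩)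
      (fun d hd => by obtain ⟨h1, h2, h3⟩ := m3 (hsupp 10 d hd); exact ⟨h1, mem_refl.1 h2, mem_refl.1 h3⟩)
      (fun d hd => by obtain ⟨h1, h2, h3⟩ := m3 (hsupp 11 d hd); exact ⟨h1, mem_refl.1 h2, mem_refl.1 h3⟩)
      e10 e1p e1q e11 e20 e2p e2q e21 tg0 tgp tgq tg1
    obtain ⟨K0, K1, K2, K3, K4, K5, K6, K7, K8, K9, K10, K11⟩ := K
    have hall : ∀ i d, a i d = 0 := by
      intro i
      fin_cases i
      exacts [K0, K1, K2, K3, K4, K5, K6, K7, K8, K9, K10, K11]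
    rintro ⟨i, ⟨d, hd⟩⟩
    have h := hall i d
    rwa [ha i d, dif_pos hd] at h
  -- count: independent vectors are at most the dimension
  have hcard := hli.fintype_card_le_finrank
  rw [Module.finrank_fintype_fun_eq_card, Fintype.card_sigma, Fintype.card_sigma] at hcard
  simp [Fin.sum_univ_succ, hSdef, hTdef, -Finset.inter_assoc] at hcard
  omega

/-! ### `TRI_W(2) ≥ 0` on the stratum -/

/-- **`TRI_W(2) ≥ 0` on the stratum `F ∅ = F {a}`, `G ∅ = G {b}`** (index cube with two atoms `a ≠ b`; `P` an up-set; `F, G` monotone families of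
up-sets).  Proof: pair reduction `LatticeFiveUpSet.triW_nonneg_of_pair_nonneg` + the counting theorem `sigma_count_stratum_FpGq` with
`(A,B,C,D,E,H) = (F ∅, F {b}, F univ, G ∅, G {a}, G univ)` — the sum of the outer and inner thin-edge functionals is exactly supplies minus demands
of the Σ certificate.  P5 gen 15: no pointwise / type-LP certificate exists on this stratum (−1/16). [this work] -/
theorem triW_nonneg_of_stratum_FpGq {β : Type} [DecidableEq β] [Fintype β] {a b : β} (hab : a ≠ b) (hu : (univ : Finset β) = {a, b})
    (P : Finset (Finset α)) (F G : Finset β → Finset (Finset α))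
    (hP : IsUpperSet (P : Set (Finset α))) (hF : ∀ x, IsUpperSet (F x : Set (Finset α))) (hG : ∀ x, IsUpperSet (G x : Set (Finset α)))
    (hFm : Monotone F) (hGm : Monotone G) (hFa : F ∅ = F {a}) (hGb : G ∅ = G {b}) : 0 ≤ triW P F G := by
  refine LatticeFiveUpSet.triW_nonneg_of_pair_nonneg hab hu P F G ?_
  have hcount := sigma_count_stratum_FpGq P (F ∅) (F {b}) (F univ) (G ∅) (G {a}) (G univ) hP
    (hF ∅) (hF {b}) (hF univ) (hG ∅) (hG {a}) (hG univ)
    (hFm (empty_subset _)) (hFm (subset_univ _)) (hGm (empty_subset _)) (hGm (subset_univ _))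
  rw [← hFa, ← hGb]
  unfold LatticeFiveUpSet.triWOne
  simp only [image_complEquiv]
  have hcount' : (((P ∩ F ∅ ∩ refl (G univ)).card : ℤ) + (P ∩ F ∅ ∩ refl (G ∅)).card + (P ∩ F {b} ∩ refl (G {a})).card
        + (P ∩ F univ ∩ refl (G ∅)).card)
      + (((P ∩ refl (F ∅) ∩ G univ).card : ℤ) + (P ∩ refl (F ∅) ∩ G ∅).card + (P ∩ refl (F {b}) ∩ G {a}).card + (P ∩ refl (F univ) ∩ G ∅).card)
      + (((P ∩ refl (F ∅) ∩ refl (G ∅)).card : ℤ) + (P ∩ refl (F ∅) ∩ refl (G {a})).card + (P ∩ refl (F {b}) ∩ refl (G ∅)).card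
        + (P ∩ refl (F univ) ∩ refl (G univ)).card)
    ≤ 2 * (((P ∩ F ∅ ∩ G ∅).card : ℤ) + (P ∩ F ∅ ∩ G {a}).card + (P ∩ F {b} ∩ G ∅).card + (P ∩ F univ ∩ G univ).card)
      + (((P ∩ refl (F ∅) ∩ refl (G univ)).card : ℤ) + (P ∩ refl (F ∅) ∩ refl (G ∅)).card + (P ∩ refl (F {b}) ∩ refl (G {a})).card
        + (P ∩ refl (F univ) ∩ refl (G ∅)).card) := by exact_mod_cast hcount
  linarith

end FiveUpSet

end Summit.CriticalPhenomena.PercolationContinuityZ3.Theorems
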